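import Summits.KontsevichZagierPeriods.KontsevichZagierPeriods.Theses.TorsionLogs
import Summits.KontsevichZagierPeriods.KontsevichZagierPeriods.Theorems.TorsionLogsNeronTorsionSector
import Literature.NumberTheory.Transcendental.KZKernelConjectureForms
import Literature.NumberTheory.Transcendental.KZLogCalculusProofs

/-!
# Crux `TorsionSectorComplete` (stmt-KontsevichZagierPeriods-14212) — line `NeronIsogeny`
# (forward generator G1 `next-rung` over the floor `NeronTorsionPrimitiveChain`, unit fwd2-rung-KontsevichZagierPeriods-01, gen 13)

Route `TorsionLogs` (route-KontsevichZagierPeriods-TorsionLogs; `closes (h₁ : NeronTorsionSector)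
(h₂ : TorsionSectorComplete) : KontsevichZagierPeriods`; `h₁` CLOSED by the landed translation chain
`NeronTorsionSector_of = NeronTorsionSector_of_primitiveChain stub_assembly`, `h₂` the open residual).

FLOOR (seed g1-KontsevichZagierPeriods-17981, CLOSED): `Theses.TorsionLogs.NeronTorsionPrimitiveChain` — the Néron–torsion
chain `q²•[rI] + p²•[rP] − c•[rB] ∈ KZ.relations` at ONE real `N`-torsion point of ONE curve `E : y² = f(x) = 4x³ − g₂x − g₃`
(`rI` = the iterated triangle `e₁ < x₁ < x₀ < x_P` of `x₁dx₁dx₀/(√f√f)`, `rP` = the quadrant carrier of `η₁ω₁/2`, `rB` a log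
carrier); every move of its proof is an automorphism of the ONE real curve `E` (translations by multiples of `P`).

ONE MOVE — THE CURVE IS QUOTIENTED, NOT FIXED: transport the Néron triangle through VÉLU'S 2-ISOGENY
`φ : E → E' := E/⟨T⟩`, `T = (e₁, 0)` the corner (the real 2-torsion point on the identity component), onto a
NON-ISOMORPHIC curve.  With `D := 3e₁² − g₂/4 = f′(e₁)/4 > 0` and `c := e₁ + √D` (the abscissa of the real 4-torsion
points `±Q`, `2Q = T`) Vélu's formulae [cite: Velu1971] read, in the normalisation `y² = 4x³ − g₂x − g₃`,
  `φ(x) = x + D/(x − e₁)`,   `x(R + T) = e₁ + D/(x_R − e₁)`,   so   `X := x(φR) = x_R + x_{R+T} − e₁`;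
  `E' : y² = F(x) = 4x³ − (60e₁² − 4g₂)·x − (g₃ + 84e₁³ − 7e₁g₂)`,  roots  `2c − e₁ = e₁ + 2√D` (largest), `e₁ − 2√D`, `−2e₁`;
  `φ^*(dx/√F) = dx/√f`,  `ω₁' = ω₁/2`,  and the QUASI-PERIOD ANOMALY  `η₁' = η₁ + e₁·ω₁/2`  (`φ^*(x dx/√F) = x dx/√f + τ_T^*(x dx/√f) − e₁·dx/√f`).
THE NEW MEMBER (value level, R a free real point with `x_R > e₁`, `S := R + T`):
  `ISO₂(R):  I'(X) − I(x_R) − I(x_S) − η₁ω₁/16 + (e₁/2)·(∫_{2c−e₁}^{X} dx/√F)² = ¼·log(D/D')`,   `D' = F′(2c − e₁)/4 = 12e₁√D + 8D`,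
where `I(x) = ∫∫_{e₁<x₁<x₀<x} x₁dx₁dx₀/(√f√f)` on `E` and `I'` the same triangle on `E'` (corner `2c − e₁`).  It is Néron's
functional equation of the archimedean local height under an isogeny, `λ'(φ z) = λ(z) + λ(z + ω₁/2) − λ(T)`
(Néron functoriality `λ_{φ^*D} = λ_D ∘ φ mod Γ` for homomorphisms of abelian varieties [cite: Lang1983, Ch. 11 Thm 1.1];
the archimedean `λ` [cite: SilvermanATAEC1994, VI Thm 3.2, Ex. 6.3–6.4]) read through the floor's dictionary
`I(x(u)) = λ̃(u) − λ̃(ω₁/2) − (η₁/2ω₁)(ω₁/2 − u)²`; the term `(e₁/2)(∫ω')²` is the signature of Vélu's `S₁ = e₁` — a product of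
two FIRST-kind periods with an algebraic coefficient, which no line on one curve can produce (under `[n]` the lattice is
homothetic and `η` scales cleanly).  NUMERICS (seat folder `num/iso2.py`: composite Gauss–Legendre after `x = e₁ + t²`;
three curves `(g₂,g₃) = (28,−24)` [Δ>0], `(−4,8)` [Δ<0], `(4,0)` [CM], eleven points on both sides of the fold `x = c`
and at it): `ω₁'/ω₁ = 0.5` and `η₁' = η₁ + e₁ω₁/2` to 1e-10, `ISO₂` to ≤ 1.8e-15 in every instance.
TIED KZ ELEMENT (integer-cleared ×8):  `8•[rI'] − 8•[rR] − 8•[rS] − [rP] + 4•[rV] − m•[rL]`, with `rI'` the `E'`-triangle,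
`rR`, `rS` the floor-shaped `E`-triangles at `x_R`, `x_S`, `rP` the floor's quadrant (`η₁ω₁/2`), `rV = [(2c−e₁, X)², e₁/(√F√F)]`
(value `e₁(∫_{2c−e₁}^X dx/√F)²`), `rL = [1<t<α, dt/t]`; VALUE HYPOTHESIS `8I' − 8I_R − 8I_S − rP + 4rV = m·log α`.
HONEST CONTAINMENT: at the fold `x_R = c` (`R = Q`, 4-torsion, `S = −Q`, `X = 2c − e₁`) the cells `rI'`, `rV` are EMPTY and
the member is the floor's tied instance `(N, a) = (4, 1)`, `(M, k) = (32, 2)` up to sign and the congruence `[rR] ~ [rS]`;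
the two-member device below records the floor VERBATIM as member `false` (the seed theorem IS that member).

WHY ONE MOVE UP NEEDS A NEW IDEA: the floor's moves are translations `τ_{kP}` of ONE curve, whose second-kind cocycle
`τ^*η − η` is EXACT; an isogeny to a different curve pulls `η'` back to `η + τ_T^*η − S₁·ω` — the class of `η` MOVES
(`S₁ = e₁ ≠ 0`), and the 2-cell must be transported by the chart `φ × φ` between different cubics.  The located first
non-floor step is the VÉLU CHART MOVE (stub A): rule 2 with `Φ = φ × φ` on the sheet `(c, max(x_R,x_S))` (`φ` is a
bijection `(c, ∞) → (2c−e₁, ∞)` with `F(φ x)·… : φ′(x)/√F(φ x) = 1/√f(x)`), landing the `E'`-cells on `E`-cells with the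
integrand `(x₁ + D/(x₁ − e₁))/(√f√f)`; the rest (stub B) is a ONE-curve folding: the inner involution
`x₁ ↦ e₁ + D/(x₁ − e₁)` (translation by `T`; `f(τx) = D²f(x)/(x − e₁)⁴`), the floor's translation calculus at the
2-torsion point `T` and the quarter-point evaluation `∫_c^∞ dx/√f = ω₁/4` (the same involution maps `(c,∞)` onto `(e₁,c)`).

FAMILY: `NeronIsogenyMember : Bool → Prop`, `false ↦` the floor decl VERBATIM (degree-1 isogeny = identity),
`true ↦ NeronVeluSector` (degree 2, kernel `⟨T⟩`); THE RUNG `NeronIsogeny := ∀ b, NeronIsogenyMember b`.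

SKELETON (3 registered stubs → the crux BY NAME):
* `stub_veluChart : VeluChart` (L, provable now from `KZ.changeOfVariablesRel`) — the chart move: `E`-cells `rT`, `rQ` exist
  with `[rI'] − [rT]`, `[rV] − [rQ] ∈ relations`.
* `stub_veluFolding : VeluFolding` (XL, THE REAL STEP) — the one-curve primitive chain
  `8•[rT] − 8•[rR] − 8•[rS] − [rP] + 4•[rQ] − c₀•[rB] ∈ relations` for some integer `c₀` and algebraic `B > 1`.
* `stub_isogenySectorComplete : IsogenySectorComplete` (residual, conjecture-grade) — completeness modulo
  `relations ⊔ closure (T ∪ T_φ)`; WEAKER than the crux (`isogenySectorComplete_of_torsionSectorComplete`).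
Proved here (no `sorry`): the primitive Vélu chain from A + B, the tied member from it (soundness + the landed log calculus
`interval_log_relation_mem_relations`), the rung, `closure T_φ ≤ relations`, `closure T ≤ relations`, the F4 on-path
theorem `KontsevichZagierPeriods → NeronIsogeny`, and `TorsionSectorComplete_of`.
-/

noncomputable section

open Set MeasureTheory Filter Topology
open Literature.NumberTheory.Transcendental Literature.ModelTheory.ExponentialFields
open Summit.KontsevichZagierPeriods.KontsevichZagierPeriods.Theses.TorsionLogs (NeronTorsionSector NeronTorsionPrimitiveChain
  NeronTorsionPrimitiveChain_holds TorsionSectorComplete)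
open Summit.KontsevichZagierPeriods.KontsevichZagierPeriods.Cruxes.NeronTorsionSector.Translation (NeronTorsionSector_of
  logRep_value isAlgebraic_of_logRep)
open Summit.KontsevichZagierPeriods.HyperbolicBloch.OffTetraSectorKernel (interval_log_relation_mem_relations)

-- `Summit.KontsevichZagierPeriods.KontsevichZagierPeriods.…` is the tree's mandated layout (single-conjunct summit).
set_option linter.dupNamespace false

namespace Summit.KontsevichZagierPeriods.KontsevichZagierPeriods.Cruxes.TorsionSectorComplete.NeronIsogeny

/-! ### Statements -/

/-- **Member `true`: the TIED VÉLU (2-ISOGENY) NÉRON SECTOR STATEMENT.**  Data: the floor's curve hypotheses verbatim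
(`f = 4x³ − g₂x − g₃`, `g₂³ ≠ 27g₃²`, largest root `e₁ > 0`, `f > 0` beyond), the quarter abscissa `c` (`e₁ < c`,
`(c − e₁)² = 3e₁² − g₂/4`), a FREE real point abscissa `x_R > e₁`, its `T`-translate `x_S` (`(x_S − e₁)(x_R − e₁) = 3e₁² − g₂/4`),
the Vélu image `X = x_R + x_S − e₁` on the isogenous cubic `F`, and representations pinned as: `rI'` = the `E'`-triangle
`2c−e₁ < z₁ < z₀ < X` of `z₁/(√F√F)`; `rR`, `rS` = the `E`-triangles at `x_R`, `x_S`; `rP` = the floor's quadrant; `rV` = the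
square `(2c−e₁, X)²` of `e₁/(√F(z₀)√F(z₁))`; `rL = [1<t<α, dt/t]`.  The VALUE HYPOTHESIS `8I' − 8I_R − 8I_S − rP + 4rV = m·rL`
gives `8•[rI'] − 8•[rR] − 8•[rS] − [rP] + 4•[rV] − m•[rL] ∈ KZ.relations`.
[cite: KontsevichZagier2001, §1.2] [cite: Velu1971] [cite: Lang1983, Ch. 11 Thm 1.1] -/
def NeronVeluSector : Prop :=
  ∀ (g₂ g₃ e₁ c xR xS X α : ℝ) (m : ℤ) (f F : ℝ → ℝ),
    (∀ x, f x = 4 * x ^ 3 - g₂ * x - g₃) → g₂ ^ 3 - 27 * g₃ ^ 2 ≠ 0 → f e₁ = 0 → 0 < e₁ →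
    (∀ x, e₁ < x → 0 < f x) → e₁ < c → (c - e₁) ^ 2 = 3 * e₁ ^ 2 - g₂ / 4 →
    e₁ < xR → (xS - e₁) * (xR - e₁) = 3 * e₁ ^ 2 - g₂ / 4 → X = xR + xS - e₁ →
    (∀ x, F x = 4 * x ^ 3 - (60 * e₁ ^ 2 - 4 * g₂) * x - (g₃ + 84 * e₁ ^ 3 - 7 * e₁ * g₂)) → 1 < α →
    ∀ (rI' rR rS rP rV : KZ.IntegralRep 2) (rL : KZ.IntegralRep 1),
    rI'.domain = {z | 2 * c - e₁ < z 1 ∧ z 1 < z 0 ∧ z 0 < X} →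
    Set.EqOn rI'.integrand (fun z => z 1 / (Real.sqrt (F (z 1)) * Real.sqrt (F (z 0)))) rI'.domain →
    rR.domain = {z | e₁ < z 1 ∧ z 1 < z 0 ∧ z 0 < xR} →
    Set.EqOn rR.integrand (fun z => z 1 / (Real.sqrt (f (z 1)) * Real.sqrt (f (z 0)))) rR.domain →
    rS.domain = {z | e₁ < z 1 ∧ z 1 < z 0 ∧ z 0 < xS} →
    Set.EqOn rS.integrand (fun z => z 1 / (Real.sqrt (f (z 1)) * Real.sqrt (f (z 0)))) rS.domain →
    rP.domain = {z | e₁ < z 0 ∧ e₁ < z 1} →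
    Set.EqOn rP.integrand
      (fun z => (Real.sqrt (f (z 0)))⁻¹ * ((g₂ * z 1 + 2 * g₃) / (2 * (z 1) ^ 2 * Real.sqrt (f (z 1))))) rP.domain →
    rV.domain = {z | 2 * c - e₁ < z 0 ∧ z 0 < X ∧ 2 * c - e₁ < z 1 ∧ z 1 < X} →
    Set.EqOn rV.integrand (fun z => e₁ / (Real.sqrt (F (z 0)) * Real.sqrt (F (z 1)))) rV.domain →
    rL.domain = {t | 1 < t 0 ∧ t 0 < α} → Set.EqOn rL.integrand (fun t => (t 0)⁻¹) rL.domain →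
    8 * rI'.value - 8 * rR.value - 8 * rS.value - rP.value + 4 * rV.value = m * rL.value →
    (8 : ℤ) • KZ.of rI' - (8 : ℤ) • KZ.of rR - (8 : ℤ) • KZ.of rS - KZ.of rP + (4 : ℤ) • KZ.of rV - m • KZ.of rL ∈
      KZ.relations

/-- **The family, graded by the isogeny (`false` ↦ the identity of `E`, `true` ↦ Vélu's 2-isogeny `E → E/⟨T⟩`).**
Member `false` is the floor decl `Theses.TorsionLogs.NeronTorsionPrimitiveChain` VERBATIM (the seed, CLOSED); member
`true` is `NeronVeluSector`.  Honest containment: see the module docstring (the fold `x_R = c` of member `true` is the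
floor's `(N,a) = (4,1)` instance with empty `E'`-cells). -/
def NeronIsogenyMember : Bool → Prop
  | false => NeronTorsionPrimitiveChain
  | true => NeronVeluSector

/-- **THE RUNG `NeronIsogeny`: both members.** `∀ b, NeronIsogenyMember b` — the proved floor and the new Vélu sector
statement. -/
def NeronIsogeny : Prop := ∀ two : Bool, NeronIsogenyMember two

/-- **The PRIMITIVE VÉLU CHAIN** (the `∃`-form of member `true`, as the floor's primitive chain): same data and pinned
representations, no `α`/`m`/`rL`/value hypothesis; there EXIST an integer `c₀`, an algebraic `B > 1` and a log carrier
`rB = [1<t<B, dt/t]` with `8•[rI'] − 8•[rR] − 8•[rS] − [rP] + 4•[rV] − c₀•[rB] ∈ KZ.relations`.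
(Value level: `c₀ log B = 2·log(D/D')`, e.g. `c₀ = −1`, `B = (D'/D)²`.) [cite: KontsevichZagier2001, §1.2] [cite: Velu1971] -/
def VeluPrimitiveChain : Prop :=
  ∀ (g₂ g₃ e₁ c xR xS X : ℝ) (f F : ℝ → ℝ),
    (∀ x, f x = 4 * x ^ 3 - g₂ * x - g₃) → g₂ ^ 3 - 27 * g₃ ^ 2 ≠ 0 → f e₁ = 0 → 0 < e₁ →
    (∀ x, e₁ < x → 0 < f x) → e₁ < c → (c - e₁) ^ 2 = 3 * e₁ ^ 2 - g₂ / 4 →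
    e₁ < xR → (xS - e₁) * (xR - e₁) = 3 * e₁ ^ 2 - g₂ / 4 → X = xR + xS - e₁ →
    (∀ x, F x = 4 * x ^ 3 - (60 * e₁ ^ 2 - 4 * g₂) * x - (g₃ + 84 * e₁ ^ 3 - 7 * e₁ * g₂)) →
    ∀ (rI' rR rS rP rV : KZ.IntegralRep 2),
    rI'.domain = {z | 2 * c - e₁ < z 1 ∧ z 1 < z 0 ∧ z 0 < X} →
    Set.EqOn rI'.integrand (fun z => z 1 / (Real.sqrt (F (z 1)) * Real.sqrt (F (z 0)))) rI'.domain →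
    rR.domain = {z | e₁ < z 1 ∧ z 1 < z 0 ∧ z 0 < xR} →
    Set.EqOn rR.integrand (fun z => z 1 / (Real.sqrt (f (z 1)) * Real.sqrt (f (z 0)))) rR.domain →
    rS.domain = {z | e₁ < z 1 ∧ z 1 < z 0 ∧ z 0 < xS} →
    Set.EqOn rS.integrand (fun z => z 1 / (Real.sqrt (f (z 1)) * Real.sqrt (f (z 0)))) rS.domain →
    rP.domain = {z | e₁ < z 0 ∧ e₁ < z 1} →
    Set.EqOn rP.integrand
      (fun z => (Real.sqrt (f (z 0)))⁻¹ * ((g₂ * z 1 + 2 * g₃) / (2 * (z 1) ^ 2 * Real.sqrt (f (z 1))))) rP.domain →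
    rV.domain = {z | 2 * c - e₁ < z 0 ∧ z 0 < X ∧ 2 * c - e₁ < z 1 ∧ z 1 < X} →
    Set.EqOn rV.integrand (fun z => e₁ / (Real.sqrt (F (z 0)) * Real.sqrt (F (z 1)))) rV.domain →
    ∃ (c₀ : ℤ) (B : ℝ) (rB : KZ.IntegralRep 1), 1 < B ∧ IsAlgebraic ℚ B ∧
      rB.domain = {t | 1 < t 0 ∧ t 0 < B} ∧ Set.EqOn rB.integrand (fun t => (t 0)⁻¹) rB.domain ∧
      (8 : ℤ) • KZ.of rI' - (8 : ℤ) • KZ.of rR - (8 : ℤ) • KZ.of rS - KZ.of rP + (4 : ℤ) • KZ.of rV - c₀ • KZ.of rB ∈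
        KZ.relations

/-- **Stub A statement (L, provable now): the VÉLU CHART MOVE.**  On the sheet `(c, x_M)`, `x_M := max(x_R, x_S)` (the
preimage of `X` above the fold; `φ : (c,∞) → (2c−e₁,∞)` is an increasing semialgebraic bijection with
`φ′(x)/√F(φ x) = 1/√f(x)`), rule 2 with `Φ = φ × φ` turns the `E'`-triangle `rI'` into the `E`-cell
`rT = [c<z₁<z₀<x_M, (z₁ + D/(z₁−e₁))/(√f√f)]` and the `E'`-square `rV` into `rQ = [(c,x_M)², e₁/(√f√f)]`:
such `rT`, `rQ` EXIST (the chart is defined over `ℚ(e₁, c) ⊂ ℚ̄`) and `[rI'] − [rT]`, `[rV] − [rQ] ∈ KZ.relations`.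
[cite: KontsevichZagier2001, §1.2 rule (2)] [cite: Velu1971] -/
def VeluChart : Prop :=
  ∀ (g₂ g₃ e₁ c xR xS X : ℝ) (f F : ℝ → ℝ),
    (∀ x, f x = 4 * x ^ 3 - g₂ * x - g₃) → g₂ ^ 3 - 27 * g₃ ^ 2 ≠ 0 → f e₁ = 0 → 0 < e₁ →
    (∀ x, e₁ < x → 0 < f x) → e₁ < c → (c - e₁) ^ 2 = 3 * e₁ ^ 2 - g₂ / 4 →
    e₁ < xR → (xS - e₁) * (xR - e₁) = 3 * e₁ ^ 2 - g₂ / 4 → X = xR + xS - e₁ →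
    (∀ x, F x = 4 * x ^ 3 - (60 * e₁ ^ 2 - 4 * g₂) * x - (g₃ + 84 * e₁ ^ 3 - 7 * e₁ * g₂)) →
    ∀ (rI' rV : KZ.IntegralRep 2),
    rI'.domain = {z | 2 * c - e₁ < z 1 ∧ z 1 < z 0 ∧ z 0 < X} →
    Set.EqOn rI'.integrand (fun z => z 1 / (Real.sqrt (F (z 1)) * Real.sqrt (F (z 0)))) rI'.domain →
    rV.domain = {z | 2 * c - e₁ < z 0 ∧ z 0 < X ∧ 2 * c - e₁ < z 1 ∧ z 1 < X} →
    Set.EqOn rV.integrand (fun z => e₁ / (Real.sqrt (F (z 0)) * Real.sqrt (F (z 1)))) rV.domain →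
    ∃ (rT rQ : KZ.IntegralRep 2),
      rT.domain = {z | c < z 1 ∧ z 1 < z 0 ∧ z 0 < max xR xS} ∧
      Set.EqOn rT.integrand
        (fun z => (z 1 + (3 * e₁ ^ 2 - g₂ / 4) / (z 1 - e₁)) / (Real.sqrt (f (z 1)) * Real.sqrt (f (z 0)))) rT.domain ∧
      rQ.domain = {z | c < z 0 ∧ z 0 < max xR xS ∧ c < z 1 ∧ z 1 < max xR xS} ∧
      Set.EqOn rQ.integrand (fun z => e₁ / (Real.sqrt (f (z 0)) * Real.sqrt (f (z 1)))) rQ.domain ∧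
      KZ.of rI' - KZ.of rT ∈ KZ.relations ∧ KZ.of rV - KZ.of rQ ∈ KZ.relations

/-- **Stub B statement (XL, THE REAL STEP): the ONE-CURVE VÉLU FOLDING CHAIN.**  On `E` alone: the chart cells `rT`, `rQ`
of stub A, the two coset triangles `rR`, `rS` (`x_S = x(R + T)`) and the floor's quadrant `rP` satisfy
`8•[rT] − 8•[rR] − 8•[rS] − [rP] + 4•[rQ] − c₀•[rB] ∈ KZ.relations` for some integer `c₀` and log carrier `rB = [1<t<B, dt/t]`,
`B > 1` algebraic (value level `c₀ log B = 2 log(D/D')`).  Plan: split the integrand of `rT` (rule 1b); the inner involution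
`x₁ ↦ e₁ + D/(x₁ − e₁)` (rule 2, `f(τx) = D²f(x)/(x−e₁)⁴`) carries the `D/(x₁−e₁)`-part to the region between the curve
`x₁ = τ(x₀)` and the fold; the floor's translation calculus at the 2-torsion point `T` (cocycle `τ_T^*η − η` exact) and
`TriangleConcatenation` fold the pieces onto `rR`, `rS`; the quarter-point evaluation `∫_c^∞ dx/√f = ω₁/4` (the same
involution) prices the corner terms against `rP` and `rQ`; logs are packaged as in the floor (`StubLogPackaging`).
[cite: KontsevichZagier2001, §1.2] [cite: SilvermanATAEC1994, VI Thm 1.1, Ex. 6.3, Ex. 6.4] [cite: Lang1987, Ch. 2] -/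
def VeluFolding : Prop :=
  ∀ (g₂ g₃ e₁ c xR xS X : ℝ) (f : ℝ → ℝ),
    (∀ x, f x = 4 * x ^ 3 - g₂ * x - g₃) → g₂ ^ 3 - 27 * g₃ ^ 2 ≠ 0 → f e₁ = 0 → 0 < e₁ →
    (∀ x, e₁ < x → 0 < f x) → e₁ < c → (c - e₁) ^ 2 = 3 * e₁ ^ 2 - g₂ / 4 →
    e₁ < xR → (xS - e₁) * (xR - e₁) = 3 * e₁ ^ 2 - g₂ / 4 → X = xR + xS - e₁ →
    ∀ (rT rQ rR rS rP : KZ.IntegralRep 2),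
    rT.domain = {z | c < z 1 ∧ z 1 < z 0 ∧ z 0 < max xR xS} →
    Set.EqOn rT.integrand
      (fun z => (z 1 + (3 * e₁ ^ 2 - g₂ / 4) / (z 1 - e₁)) / (Real.sqrt (f (z 1)) * Real.sqrt (f (z 0)))) rT.domain →
    rQ.domain = {z | c < z 0 ∧ z 0 < max xR xS ∧ c < z 1 ∧ z 1 < max xR xS} →
    Set.EqOn rQ.integrand (fun z => e₁ / (Real.sqrt (f (z 0)) * Real.sqrt (f (z 1)))) rQ.domain →
    rR.domain = {z | e₁ < z 1 ∧ z 1 < z 0 ∧ z 0 < xR} →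
    Set.EqOn rR.integrand (fun z => z 1 / (Real.sqrt (f (z 1)) * Real.sqrt (f (z 0)))) rR.domain →
    rS.domain = {z | e₁ < z 1 ∧ z 1 < z 0 ∧ z 0 < xS} →
    Set.EqOn rS.integrand (fun z => z 1 / (Real.sqrt (f (z 1)) * Real.sqrt (f (z 0)))) rS.domain →
    rP.domain = {z | e₁ < z 0 ∧ e₁ < z 1} →
    Set.EqOn rP.integrand
      (fun z => (Real.sqrt (f (z 0)))⁻¹ * ((g₂ * z 1 + 2 * g₃) / (2 * (z 1) ^ 2 * Real.sqrt (f (z 1))))) rP.domain →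
    ∃ (c₀ : ℤ) (B : ℝ) (rB : KZ.IntegralRep 1), 1 < B ∧ IsAlgebraic ℚ B ∧
      rB.domain = {t | 1 < t 0 ∧ t 0 < B} ∧ Set.EqOn rB.integrand (fun t => (t 0)⁻¹) rB.domain ∧
      (8 : ℤ) • KZ.of rT - (8 : ℤ) • KZ.of rR - (8 : ℤ) • KZ.of rS - KZ.of rP + (4 : ℤ) • KZ.of rQ - c₀ • KZ.of rB ∈
        KZ.relations

/-- The identity-component tied set `T` of the crux `TorsionSectorComplete` (copied verbatim). -/
def TorsionTied : Set Literature.NumberTheory.Transcendental.KZ.FormalRep := {d : Literature.NumberTheory.Transcendental.KZ.FormalRep | ∃ (g₂ g₃ e₁ xP yP α : ℝ) (N a : ℕ) (M k m : ℤ) (f : ℝ → ℝ) (rI rP : Literature.NumberTheory.Transcendental.KZ.IntegralRep 2) (rL : Literature.NumberTheory.Transcendental.KZ.IntegralRep 1), (∀ x, f x = 4 * x ^ 3 - g₂ * x - g₃) ∧ g₂ ^ 3 - 27 * g₃ ^ 2 ≠ 0 ∧ f e₁ = 0 ∧ 0 < e₁ ∧ (∀ x, e₁ < x → 0 < f x)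 ∧ e₁ < xP ∧ yP ^ 2 = f xP ∧ 3 ≤ N ∧ 0 < a ∧ 2 * a < N ∧ 4 * (N : ℤ) ^ 2 * k = M * ((N : ℤ) - 2 * (a : ℤ)) ^ 2 ∧ (∀ hns : (⟨0, 0, 0, -g₂ / 4, -g₃ / 4⟩ : WeierstrassCurve ℝ).toAffine.Nonsingular xP (yP / 2), addOrderOf (WeierstrassCurve.Affine.Point.some xP (yP / 2) hns) = N) ∧ (N : ℝ) * (∫ x in Set.Ioi xP, (Real.sqrt (f x))⁻¹) = a * (2 * ∫ x in Set.Ioi e₁, (Real.sqrt (f x))⁻¹) ∧ 1 < α ∧ rI.domain = {z | e₁ < z 1 ∧ z 1 < z 0 ∧ z 0 < xP} ∧ Set.EqOn rI.integrand (fun z => z 1 / (Real.sqrt (f (z 1)) * Real.sqrt (f (z 0)))) rI.domain ∧ rP.domain = {z | e₁ < z 0 ∧ e₁ < z 1} ∧ Set.EqOn rP.integrand (fun z => (Real.sqrt (f (z 0)))⁻¹ * ((g₂ * z 1 + 2 * g₃) / (2 * (z 1) ^ 2 * Real.sqrt (f (z 1))))) rP.domain ∧ rL.domain = {t | 1 <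 t 0 ∧ t 0 < α} ∧ Set.EqOn rL.integrand (fun t => (t 0)⁻¹) rL.domain ∧ (M : ℝ) * rI.value + k * rP.value = m * rL.value ∧ d = M • Literature.NumberTheory.Transcendental.KZ.of rI + k • Literature.NumberTheory.Transcendental.KZ.of rP - m • Literature.NumberTheory.Transcendental.KZ.of rL}

/-- The tied VÉLU set `T_φ`: the elements of member `true`, with their value hypothesis. -/
def VeluTied : Set KZ.FormalRep :=
  {d | ∃ (g₂ g₃ e₁ c xR xS X α : ℝ) (m : ℤ) (f F : ℝ → ℝ) (rI' rR rS rP rV : KZ.IntegralRep 2) (rL : KZ.IntegralRep 1),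
    (∀ x, f x = 4 * x ^ 3 - g₂ * x - g₃) ∧ g₂ ^ 3 - 27 * g₃ ^ 2 ≠ 0 ∧ f e₁ = 0 ∧ 0 < e₁ ∧
    (∀ x, e₁ < x → 0 < f x) ∧ e₁ < c ∧ (c - e₁) ^ 2 = 3 * e₁ ^ 2 - g₂ / 4 ∧
    e₁ < xR ∧ (xS - e₁) * (xR - e₁) = 3 * e₁ ^ 2 - g₂ / 4 ∧ X = xR + xS - e₁ ∧
    (∀ x, F x = 4 * x ^ 3 - (60 * e₁ ^ 2 - 4 * g₂) * x - (g₃ + 84 * e₁ ^ 3 - 7 * e₁ * g₂)) ∧ 1 < α ∧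
    rI'.domain = {z | 2 * c - e₁ < z 1 ∧ z 1 < z 0 ∧ z 0 < X} ∧
    Set.EqOn rI'.integrand (fun z => z 1 / (Real.sqrt (F (z 1)) * Real.sqrt (F (z 0)))) rI'.domain ∧
    rR.domain = {z | e₁ < z 1 ∧ z 1 < z 0 ∧ z 0 < xR} ∧
    Set.EqOn rR.integrand (fun z => z 1 / (Real.sqrt (f (z 1)) * Real.sqrt (f (z 0)))) rR.domain ∧
    rS.domain = {z | e₁ < z 1 ∧ z 1 < z 0 ∧ z 0 < xS} ∧
    Set.EqOn rS.integrand (fun z => z 1 / (Real.sqrt (f (z 1)) * Real.sqrt (f (z 0)))) rS.domain ∧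
    rP.domain = {z | e₁ < z 0 ∧ e₁ < z 1} ∧
    Set.EqOn rP.integrand
      (fun z => (Real.sqrt (f (z 0)))⁻¹ * ((g₂ * z 1 + 2 * g₃) / (2 * (z 1) ^ 2 * Real.sqrt (f (z 1))))) rP.domain ∧
    rV.domain = {z | 2 * c - e₁ < z 0 ∧ z 0 < X ∧ 2 * c - e₁ < z 1 ∧ z 1 < X} ∧
    Set.EqOn rV.integrand (fun z => e₁ / (Real.sqrt (F (z 0)) * Real.sqrt (F (z 1)))) rV.domain ∧
    rL.domain = {t | 1 < t 0 ∧ t 0 < α} ∧ Set.EqOn rL.integrand (fun t => (t 0)⁻¹) rL.domain ∧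
    8 * rI'.value - 8 * rR.value - 8 * rS.value - rP.value + 4 * rV.value = m * rL.value ∧
    d = (8 : ℤ) • KZ.of rI' - (8 : ℤ) • KZ.of rR - (8 : ℤ) • KZ.of rS - KZ.of rP + (4 : ℤ) • KZ.of rV - m • KZ.of rL}

/-- **Stub D statement (residual, conjecture-grade): completeness off the sector enlarged by the Vélu elements.**
Two rational-shape representations with equal values differ by an element of `relations ⊔ closure (T ∪ T_φ)`.  Between
`KZKernelConjecture` (`relations` alone) and the crux (`relations ⊔ closure T`); WEAKER than the crux
(`isogenySectorComplete_of_torsionSectorComplete`). [cite: KontsevichZagier2001, §1.2 Conjecture 1] -/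
def IsogenySectorComplete : Prop := ∀ ⦃n m : ℕ⦄ (r : KZ.IntegralRep n) (r' : KZ.IntegralRep m),
  r.IsRational → r'.IsRational → r.value = r'.value → KZ.of r - KZ.of r' ∈ KZ.relations ⊔ AddSubgroup.closure (TorsionTied ∪ VeluTied)

/-! ### Registered stubs -/

/-- **Stub A (L, provable now).** `VeluChart`. -/
theorem stub_veluChart : VeluChart := by
  sorry

/-- **Stub B (XL, load-bearing, the new move).** `VeluFolding`. -/
theorem stub_veluFolding : VeluFolding := by
  sorry

/-- **Stub D (residual, conjecture-grade).** `IsogenySectorComplete`. -/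
theorem stub_isogenySectorComplete : IsogenySectorComplete := by
  sorry

/-! ### Proved infrastructure (no `sorry` below this line) -/

/-- The crux unfolds to completeness relative to `relations ⊔ closure T`. -/
theorem torsionSectorComplete_iff :
    TorsionSectorComplete ↔ ∀ ⦃n m : ℕ⦄ (r : KZ.IntegralRep n) (r' : KZ.IntegralRep m), r.IsRational → r'.IsRational →
      r.value = r'.value → KZ.of r - KZ.of r' ∈ KZ.relations ⊔ AddSubgroup.closure TorsionTied :=
  Iff.rfl

/-- Member `false` is the floor, definitionally. -/
theorem member_false_iff : NeronIsogenyMember false ↔ NeronTorsionPrimitiveChain := Iff.rfl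

/-- Member `true` is the Vélu sector statement, definitionally. -/
theorem member_true_iff : NeronIsogenyMember true ↔ NeronVeluSector := Iff.rfl

/-- The rung is the floor plus the new member. -/
theorem neronIsogeny_iff : NeronIsogeny ↔ NeronTorsionPrimitiveChain ∧ NeronVeluSector := by
  constructor
  · exact fun h => ⟨h false, h true⟩
  · rintro ⟨h₀, h₁⟩ (_ | _)
    · exact h₀
    · exact h₁

/-- **F3 WITNESS: the rung at the floor.** Member `false` is the CLOSED seed `NeronTorsionPrimitiveChain`
(`Cruxes.NeronTorsionSector.Translation.stub_assembly`, landed; route link `NeronTorsionPrimitiveChain_holds`). -/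
theorem rung_false : NeronIsogenyMember false := NeronTorsionPrimitiveChain_holds

/-- **The primitive Vélu chain from stubs A and B** (pure logic: the chart cells of A feed B, and
`8([rI'] − [rT]) + 4([rV] − [rQ]) + (8[rT] − 8[rR] − 8[rS] − [rP] + 4[rQ] − c₀[rB])` is the element). -/
theorem veluPrimitiveChain_of (hA : VeluChart) (hB : VeluFolding) : VeluPrimitiveChain := by
  intro g₂ g₃ e₁ c xR xS X f F hf hdisc he he0 hpos hc hcD hxR hS hX hF rI' rR rS rP rV hdI hiI hdR hiR hdS hiS hdP
    hiP hdV hiV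
  obtain ⟨rT, rQ, hdT, hiT, hdQ, hiQ, hIT, hVQ⟩ :=
    hA g₂ g₃ e₁ c xR xS X f F hf hdisc he he0 hpos hc hcD hxR hS hX hF rI' rV hdI hiI hdV hiV
  obtain ⟨c₀, B, rB, hB, hBalg, hdB, hiB, hfold⟩ :=
    hB g₂ g₃ e₁ c xR xS X f hf hdisc he he0 hpos hc hcD hxR hS hX rT rQ rR rS rP hdT hiT hdQ hiQ hdR hiR hdS hiS hdP hiP
  refine ⟨c₀, B, rB, hB, hBalg, hdB, hiB, ?_⟩
  have e : (8 : ℤ) • KZ.of rI' - (8 : ℤ) • KZ.of rR - (8 : ℤ) • KZ.of rS - KZ.of rP + (4 : ℤ) • KZ.of rV - c₀ • KZ.of rB =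
      (8 : ℤ) • (KZ.of rI' - KZ.of rT) + (4 : ℤ) • (KZ.of rV - KZ.of rQ) +
        ((8 : ℤ) • KZ.of rT - (8 : ℤ) • KZ.of rR - (8 : ℤ) • KZ.of rS - KZ.of rP + (4 : ℤ) • KZ.of rQ - c₀ • KZ.of rB) := by
    module
  rw [e]
  exact KZ.relations.add_mem (KZ.relations.add_mem (KZ.relations.zsmul_mem hIT 8) (KZ.relations.zsmul_mem hVQ 4)) hfold

/-- **Bookkeeping: the primitive Vélu chain gives the tied member.**  Soundness of `relations`
(`KZ.relations_le_ker_eval_holds`) and the value hypothesis give `c₀ log B = m log α` between logarithms of real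
algebraic numbers (`α` algebraic because `(1, α)` is `ℚ`-semialgebraic), realised by moves by the landed log calculus
(`interval_log_relation_mem_relations`); the tied element is the primitive one plus `c₀•[rB] − m•[rL]`.
[cite: KontsevichZagier2001, §1.2] -/
theorem veluSector_of_primitiveChain (hPC : VeluPrimitiveChain) : NeronVeluSector := by
  intro g₂ g₃ e₁ c xR xS X α m f F hf hdisc he he0 hpos hc hcD hxR hS hX hF hα rI' rR rS rP rV rL hdI hiI hdR hiR hdS
    hiS hdP hiP hdV hiV hdL hiL hval
  obtain ⟨c₀, B, rB, hB, hBalg, hdB, hiB, hprim⟩ :=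
    hPC g₂ g₃ e₁ c xR xS X f F hf hdisc he he0 hpos hc hcD hxR hS hX hF rI' rR rS rP rV hdI hiI hdR hiR hdS hiS hdP hiP
      hdV hiV
  have hvB : rB.value = Real.log B := logRep_value hB.le rB hdB hiB
  have hvL : rL.value = Real.log α := logRep_value hα.le rL hdL hiL
  have hαalg : IsAlgebraic ℚ α := isAlgebraic_of_logRep hα rL hdL
  have h0 : 8 * rI'.value - 8 * rR.value - 8 * rS.value - rP.value + 4 * rV.value - c₀ * Real.log B = 0 := by
    have h := KZ.relations_le_ker_eval_holds hprim
    rw [AddMonoidHom.mem_ker] at h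
    simp only [map_add, map_sub, map_zsmul, KZ.eval_of, zsmul_eq_mul, hvB] at h
    push_cast at h
    linear_combination h
  have hlog : (c₀ : ℝ) * Real.log B - m * Real.log α = 0 := by
    rw [hvL] at hval
    linear_combination hval - h0
  have hiB1 : Set.EqOn rB.integrand (fun t : Fin 1 → ℝ => 1 / t 0) rB.domain := fun t ht => by
    simp only [hiB ht, one_div]
  have hiL1 : Set.EqOn rL.integrand (fun t : Fin 1 → ℝ => 1 / t 0) rL.domain := fun t ht => by
    simp only [hiL ht, one_div]
  have hL : c₀ • KZ.of rB - m • KZ.of rL ∈ KZ.relations := by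
    have h := interval_log_relation_mem_relations 2 ![1, 1] ![B, α] ![c₀, -m] ![rB, rL]
      (fun i => by fin_cases i <;> simp)
      (fun i => by fin_cases i <;> simp [hB.le, hα.le])
      (fun i => by fin_cases i <;> exact isAlgebraic_one)
      (fun i => by fin_cases i <;> simp [hBalg, hαalg])
      (fun i => by
        fin_cases i
        · exact ⟨hdB, hiB1⟩
        · exact ⟨hdL, hiL1⟩)
      (by
        simp only [Fin.sum_univ_two, Matrix.cons_val_zero, Matrix.cons_val_one, div_one, Int.cast_neg]
        linear_combination hlog)
    have e : ∑ i : Fin 2, (![c₀, -m] i : ℤ) • KZ.of (![rB, rL] i) = c₀ • KZ.of rB - m • KZ.of rL := by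
      simp only [Fin.sum_univ_two, Matrix.cons_val_zero, Matrix.cons_val_one, neg_smul]
      abel
    rw [e] at h
    exact h
  have e : (8 : ℤ) • KZ.of rI' - (8 : ℤ) • KZ.of rR - (8 : ℤ) • KZ.of rS - KZ.of rP + (4 : ℤ) • KZ.of rV - m • KZ.of rL =
      ((8 : ℤ) • KZ.of rI' - (8 : ℤ) • KZ.of rR - (8 : ℤ) • KZ.of rS - KZ.of rP + (4 : ℤ) • KZ.of rV - c₀ • KZ.of rB) +
        (c₀ • KZ.of rB - m • KZ.of rL) := by
    abel
  rw [e]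
  exact KZ.relations.add_mem hprim hL

/-- **The rung from stubs A and B** (the floor is a theorem). -/
theorem NeronIsogeny_of (hA : VeluChart) (hB : VeluFolding) : NeronIsogeny :=
  neronIsogeny_iff.mpr ⟨NeronTorsionPrimitiveChain_holds, veluSector_of_primitiveChain (veluPrimitiveChain_of hA hB)⟩

/-- The Vélu member says exactly `closure T_φ ≤ KZ.relations`. [cite: KontsevichZagier2001, §1.2] -/
theorem closure_veluTied_le_relations (h : NeronVeluSector) : AddSubgroup.closure VeluTied ≤ KZ.relations := by
  refine (AddSubgroup.closure_le _).mpr ?_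
  rintro d ⟨g₂, g₃, e₁, c, xR, xS, X, α, m, f, F, rI', rR, rS, rP, rV, rL, hf, hdisc, he, he0, hpos, hc, hcD, hxR, hS, hX,
    hF, hα, hdI, hiI, hdR, hiR, hdS, hiS, hdP, hiP, hdV, hiV, hdL, hiL, hval, rfl⟩
  exact h g₂ g₃ e₁ c xR xS X α m f F hf hdisc he he0 hpos hc hcD hxR hS hX hF hα rI' rR rS rP rV rL hdI hiI hdR hiR hdS
    hiS hdP hiP hdV hiV hdL hiL hval

/-- The identity-component sector (the route's CLOSED sibling crux `NeronTorsionSector`, landed as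
`NeronTorsionSector_of`) says exactly `closure T ≤ KZ.relations`. [cite: KontsevichZagier2001, §1.2] -/
theorem closure_torsionTied_le_relations : AddSubgroup.closure TorsionTied ≤ KZ.relations := by
  have h : NeronTorsionSector := NeronTorsionSector_of
  refine (AddSubgroup.closure_le _).mpr ?_
  rintro d ⟨g₂, g₃, e₁, xP, yP, α, N, a, M, k, m', f, rI, rP, rL, hf, hdisc, he, he0, hpos, hx, hy, hN, ha,
    ha', htie, hord, htor, hα, hdI, hiI, hdP, hiP, hdL, hiL, hval, rfl⟩
  exact h g₂ g₃ e₁ xP yP α N a M k m' f hf hdisc he he0 hpos hx hy hN ha ha' htie hord htor hα rI rP rL hdI hiI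
    hdP hiP hdL hiL hval

/-- **F4 ON-PATH, new member:** Conjecture 1 (kernel form, `kzKernelConjecture_iff_isRational`) gives the tied Vélu
statement — the element evaluates to the value hypothesis.  Tagged `@[simp]` so that the tribunal's forward probe
`S → Rung` closes. [cite: KontsevichZagier2001, §1.2] -/
@[simp] theorem veluSector_of_kontsevichZagierPeriods (h : _root_.KontsevichZagierPeriods) : NeronVeluSector := by
  have hK : KZKernelConjecture := kzKernelConjecture_iff_isRational.mpr h
  intro g₂ g₃ e₁ c xR xS X α m f F _ _ _ _ _ _ _ _ _ _ _ _ rI' rR rS rP rV rL _ _ _ _ _ _ _ _ _ _ _ _ hval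
  apply hK
  simp only [map_sub, map_add, map_zsmul, KZ.eval_of, zsmul_eq_mul]
  push_cast
  linear_combination hval

/-- **F4 ON-PATH LEMMA: the summit implies the rung** (member `false` is a theorem outright). -/
@[simp] theorem neronIsogeny_of_kontsevichZagierPeriods (h : _root_.KontsevichZagierPeriods) : NeronIsogeny :=
  neronIsogeny_iff.mpr ⟨NeronTorsionPrimitiveChain_holds, veluSector_of_kontsevichZagierPeriods h⟩

/-- The same, as an implication (the literal shape `S → Rung` of the forward probe). -/
theorem onPath : _root_.KontsevichZagierPeriods → NeronIsogeny :=
  neronIsogeny_of_kontsevichZagierPeriods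

/-- The residual is a consequence of the crux (hence of the summit): `closure T ≤ closure (T ∪ T_φ)`.
(Informational: stub D is WEAKER than the crux as typed.) [folklore] -/
theorem isogenySectorComplete_of_torsionSectorComplete (h : TorsionSectorComplete) : IsogenySectorComplete := by
  intro n m r r' hr hr' hv
  have hmono : KZ.relations ⊔ AddSubgroup.closure TorsionTied ≤ KZ.relations ⊔ AddSubgroup.closure (TorsionTied ∪ VeluTied) :=
    sup_le_sup_left (AddSubgroup.closure_mono Set.subset_union_left) _
  exact hmono (torsionSectorComplete_iff.mp h r r' hr hr' hv)

/-! ### Composition: the crux BY NAME from the three stubs -/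

/-- **The folding inequality (sorry-free, stubs A + B as hypotheses):** stubs A + B give the rung's new member
(`veluSector_of_primitiveChain ∘ veluPrimitiveChain_of`), which folds the Vélu sector into the moves
(`closure T_φ ≤ relations`), so the residual's `relations ⊔ closure (T ∪ T_φ)` is `≤ relations ⊔ closure T`.
[cite: KontsevichZagier2001, §1.2] -/
theorem sup_closure_le_of_chart_folding (hA : VeluChart) (hB : VeluFolding) :
    KZ.relations ⊔ AddSubgroup.closure (TorsionTied ∪ VeluTied) ≤ KZ.relations ⊔ AddSubgroup.closure TorsionTied := by
  have hR : NeronVeluSector := veluSector_of_primitiveChain (veluPrimitiveChain_of hA hB)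
  refine sup_le le_sup_left ((AddSubgroup.closure_le _).mpr ?_)
  rintro d (hd | hd)
  · exact AddSubgroup.mem_sup_right (AddSubgroup.subset_closure hd)
  · exact AddSubgroup.mem_sup_left (closure_veluTied_le_relations hR (AddSubgroup.subset_closure hd))

/-- **`TorsionSectorComplete` BY NAME from the three registered stubs** — the ONLY theorem of this file concluding the crux;
the implication `VeluChart → VeluFolding → IsogenySectorComplete → TorsionSectorComplete` is the `suffices` step (closed term,
no `sorry`); `sorry` enters only through `stub_veluChart`, `stub_veluFolding` and `stub_isogenySectorComplete`.
[cite: KontsevichZagier2001, §1.2] -/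
theorem TorsionSectorComplete_of : TorsionSectorComplete := by
  suffices key : VeluChart → VeluFolding → IsogenySectorComplete → TorsionSectorComplete from
    key stub_veluChart stub_veluFolding stub_isogenySectorComplete
  intro hA hB hD
  rw [torsionSectorComplete_iff]
  intro n m r r' hr hr' hv
  exact sup_closure_le_of_chart_folding hA hB (hD r r' hr hr' hv)

end Summit.KontsevichZagierPeriods.KontsevichZagierPeriods.Cruxes.TorsionSectorComplete.NeronIsogeny

end
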